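import Summits.KontsevichZagierPeriods.KontsevichZagierPeriods.Theses.ValuedFieldSpecialisation
import Literature.NumberTheory.Transcendental.KZDominatedFamily

/-!
# Route ValuedFieldSpecialisation — support item `DominatedSliceTendsto`

Dominated families of integral representations specialise at value level: under the
domination / a.e.-special-fibre clauses of (CT3) — verbatim
`Literature.NumberTheory.Transcendental.KZ.IsDominatedFamily R r₀ g` — the slice integrals
`I_R(s) = ∫ x in {x | (s, x) ∈ R.domain}, R.integrand (s, x)` tend to `r₀.value` as `s → 0⁺`.

The analysis (Lebesgue dominated convergence along the countably generated filter `𝓝[>] 0`,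
envelope `𝟙_{g.domain} |g.integrand|`, a.e. limit from clauses (2) and (3), measurability of the
slices from Tarski–Seidenberg) is the Literature theorem
`Literature.NumberTheory.Transcendental.KZ.IsDominatedFamily.tendsto_setIntegral`
(`Literature/NumberTheory/Transcendental/KZDominatedFamily.lean`); the route declaration is that
statement with the definition `KZ.IsDominatedFamily` unfolded (`KZ.isDominatedFamily_iff` is
`Iff.rfl`), so this file is the one-line bridge closing item stmt-KontsevichZagierPeriods-3502.

References: T. Kaiser, Proc. LMS 116 (2018), Thm. 5.2 (the non-archimedean mirror);
Mathlib `MeasureTheory.tendsto_integral_filter_of_dominated_convergence`.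
-/

namespace Summit.KontsevichZagierPeriods.ValuedFieldSpecialisation

open Literature.NumberTheory.Transcendental

/-- **Dominated families specialise at value level** (route ValuedFieldSpecialisation, support
item `DominatedSliceTendsto`, stmt-KontsevichZagierPeriods-3502): for an `(n+1)`-dimensional
integral representation `R` dominated near `s = 0⁺` by `g` with a.e. special fibre `r₀`, the slice
integrals `∫ x in {x | vecCons s x ∈ R.domain}, R.integrand (vecCons s x)` tend to `r₀.value` along
`𝓝[>] 0`. Immediate from `KZ.IsDominatedFamily.tendsto_setIntegral` (Lebesgue dominated
convergence), the hypothesis being `KZ.IsDominatedFamily R r₀ g` by definition. -/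
theorem dominatedSliceTendsto_proof :
    Summit.KontsevichZagierPeriods.KontsevichZagierPeriods.Theses.ValuedFieldSpecialisation.DominatedSliceTendsto := by
  unfold Summit.KontsevichZagierPeriods.KontsevichZagierPeriods.Theses.ValuedFieldSpecialisation.DominatedSliceTendsto
  intro n R r₀ g h
  have h' : KZ.IsDominatedFamily R r₀ g := (KZ.isDominatedFamily_iff R r₀ g).mpr h
  exact h'.tendsto_setIntegral

end Summit.KontsevichZagierPeriods.ValuedFieldSpecialisation
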